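import Summits.QuantumFields.BalabanUV.T4Continuum.Spine.NE5.EnvelopeOnRecord
import Summits.QuantumFields.BalabanUV.T4Continuum.Spine.NE5.TwoRunTorusParam

/-!
# BalabanUVNodes ∕ N18 — THE H-LAYER ACTIVITY DATUM OF ROUTE P1 ON THE RECORD'S TORUS CATALOGUE, FROM THE (2.26)-TERM
# LAYER IN THE DATA DIRECTION (Track A, DAG node N18 = NE5 `T4OutputRate.NE5 EA EB W κ θ C₅` :211; cluster K4 «SpineRates»)

HONEST FRAMING.  Count-neutral kernel bookkeeping (seat pub-ymgap-dag-n18-c g0, strategy s1; `--supports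
stmt-QuantumFields-19676`): the composition BY NAME of LANDED interfaces — `Spine/NE5/EnvelopeOnRecord` (p341430: route P1's
W2 wall on the carriers of record with every geometry binder discharged; hypothesis left = the H-LAYER ACTIVITY DATUM `hH`),
`Spine/NE5/TwoRunTorusParam.bound238_torus_param` (Lemma 3 (2.38) for every member of a parametrised family of (2.14)-terms
from (2.26) uniform on the parameter set) and the printed term catalogue `B13Lemma3TorusTerms.terms` of the activity `H(Z)`
on the two-scale torus.  Every analytic letter below is a HYPOTHESIS: the per-term bound (2.26) on the two-margin data box
is NODE A's content ([II] Lemma 3's proof, (2.15)–(2.26)) re-read on the CLASS (1.5) p. 3 (*"we can replace the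
propagators by arbitrary operators having the same regularity properties and satisfying the same bounds"*) and is NOT
supplied; the terms `T j Z t` as FUNCTIONS OF THE STEP'S DATA are parameters (NODE O's objects, instance 0∕1); NE5 is NOT
IN PRINT ([Balaban1987RG1] Thm 1 p. 259: uniformity in ε only) and NOT PROVED here; NOT a node discharge; one finite
four-torus programme at fixed ε; nothing continuum ∕ ℝ⁴ ∕ OS ∕ mass-gap ∕ Clay.  0 `def`, 0 `sorry`.

THE POINT.  Route P1's END on the carriers of record (`EnvelopeOnRecord.ne5_of_leaves_fibre_activities_record_eps`) consumes,
per creation scale `j`, ACTIVITIES `act j : Op × Hist → 𝐃_j → ℂ` — the (2.14)-activities `H(Z)` as functions of the step's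
(operator, history) data — together with the H-LAYER DATUM `hH`: around every admissible base point `p ∈ M.Base j g U` an
OPEN data region `V ⊇ M.box j p` (the two-margin box: operator perturbations (2.16)–(2.17), potential budget (2.18)) on
which every `z ↦ act j z Z` is complex differentiable and `‖act j z Z‖ ≤ A·e^{−R_d·d(Z)}`.  The cell's witnesses
(`EnvelopeOnRecordWitness(Data)`) inhabit `hH` with toy activities only.  THIS FILE instantiates the activities by the
printed RESUMMATION SHAPE and moves the datum one layer down, in the data direction:
  `act j z Z := Σ_{t ∈ terms L M Z} T j Z t z`,
the finite sum over the printed terms `t = (𝐃, P)` of `H(Z)` ([II] (2.9) p. 14, (2.14) p. 15; the tree's over-counted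
torus catalogue `B13Lemma3TorusTerms.terms L M Z`, `Z ∈ 𝐃_{k+1} = TDom 4 (R.cubesPerDir j)`, fine torus
`TDom 4 (L·R.cubesPerDir j)`), for ANY family of term functions `T j Z t : Op × Hist → ℂ`.  Then `hH` holds with the
PRINTED letters `A = C₃ε₁`, `R_d = (1−8δ)½Lκ` as soon as, on the same open `V ⊇ M.box j p`:
  (hol)  every term `z ↦ T j Z t z` is complex differentiable on `V`;
  (226)  every term obeys (2.26) UNIFORMLY ON `V`: `‖T j Z t z‖ ≤ weight L M c Z a t · e^{a₅|Z|}` ([II] p. 17);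
and Lemma 3's printed restrictions on the constants hold (verbatim the numerics of
`B13Lemma3TorusTerms.bound238_torus_of_226`; scale-uniform, as in print).  Holomorphy of the finite sum is free; the
majorant is the tree's TORUS-MODEL LEMMA 3 read at each data point `z ∈ V` (`bound238_torus_param`, configuration-free:
read at the one-point configuration space).
* §1 `hLayer_of_terms226` — ONE torus, ANY complex data space `P`: (hol) + (226) on `V` + numerics ⟹ the activity
  `z ↦ Σ_t T Z t z` is complex differentiable on `V` and bounded there by `C₃ε₁·e^{−(1−8δ)½Lκ·d_{k+1}(Z)}`.
* §2 `hH_of_terms226_record` — ON THE CARRIERS OF RECORD `B13Carriers.TwoRuns.carriers R` for a step model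
  `M : StepModel R.carriers Op Hist`: the ∃V-form of `hH`, LITERALLY the hypothesis of
  `EnvelopeOnRecord.outputEnvelope_of_activities_record`, from the ∃V-form of (hol) + (226).
* §3 `outputEnvelope_of_terms226_record` — ∘ `EnvelopeOnRecord.outputEnvelope_of_activities_record`:
  `OutputEnvelope W κ (e·9·64·K₀(64,8)²·C₃ε₁)` under (2.13) as the definition of the output on the catalogue and the located
  numerals `κ + 128·log 162 + 2 ≤ (1−8δ)½L·c.κ`, `C₃ε₁·e^{5κ+1}·K₀(64,8)·576 ≤ 1`;
  `ne5_of_leaves_fibre_terms226_record_eps` — ∘ `EnvelopeOnRecord.ne5_of_leaves_fibre_activities_record_eps`: route P1's END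
  E1′ on the carriers of record, `T4OutputRate.NE5 EA EB W κ θ′ C₅` BY NAME, with W2 := TERM-LEVEL (2.26) DATA IN THE DATA
  DIRECTION and both W2 clauses as ε₁-THRESHOLDS (`C₃ := c.C3act`, `ε₁ := c.ε₁`); every other leaf displayed unchanged.
So after this file route P1's W2 wall for N18 sits where the two-run END (`N18EndLetters`) and row (D4) sit: at the
(2.26)-TERM layer — per term `(𝐃, P)`, (2.26) on the data box + holomorphy in the data — and no H-layer ∕ resummation ∕
cluster-sum obligation is left on N18's side of route P1.  NOT COVERED: (hol) and (226) for Bałaban's actual terms (NODE A on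
the class (1.5) + NODE O's objects; file 2 of this seat reduces them further to the (2.14)-display: separate σ∕τ-holomorphy,
corner values, the Gaussian sup bound (2.15)–(2.25) uniform on `V`); the other leaves of the END (rows NE2∕NE3, W3, levels).

Sources: T. Bałaban, CMP **116** (1988) [Balaban1988RG2Cluster] (1.5) p. 3, (2.9) p. 14, (2.13)–(2.14) pp. 14–15, p. 15
(analyticity), (2.16)–(2.18) p. 16, (2.26) p. 17, Lemma 3 (2.38) p. 20, (2.39)–(2.41) p. 21; CMP **109** (1987)
[Balaban1987RG1] p. 251 (periodic carrier), (0.24) p. 257, Thm 1 p. 259; R. Kotecký, D. Preiss, CMP **103** (1986)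
[KoteckyPreiss1986].  Nothing here is a claim about the Yang–Mills mass gap.
-/

noncomputable section

namespace Summit.QuantumFields.YangMills.BalabanUVNodes.N18HLayerDatum

open Set Metric Finset
open Literature.MathematicalPhysics.QuantumFieldTheory.Balaban1983to89
open Literature.MathematicalPhysics.QuantumFieldTheory.Balaban1983to89.T4OutputRate
open Literature.MathematicalPhysics.QuantumFieldTheory.Balaban1983to89.T4InputCauchyRateData
open Literature.MathematicalPhysics.QuantumFieldTheory.Balaban1983to89.TreeLengthTorus (TPt TDom tsys torusTreeLen tsys_dj)
open Literature.MathematicalPhysics.QuantumFieldTheory.Balaban1983to89.TreeLengthTorusGeometry (TTouch)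
open Literature.MathematicalPhysics.QuantumFieldTheory.Balaban1983to89.B13Lemma3TorusData (TBond)
open Literature.MathematicalPhysics.QuantumFieldTheory.Balaban1983to89.B13Lemma3Torus (TwoTorusStep)
open Literature.MathematicalPhysics.QuantumFieldTheory.Balaban1983to89.B13Lemma3TorusTerms (terms weight)
open Literature.MathematicalPhysics.QuantumFieldTheory.Balaban1983to89.B12TreeDecay (kappa₀ K₀)
open Literature.MathematicalPhysics.QuantumFieldTheory.Balaban1983to89.B13Resummation (locE)
open Summit.QuantumFields.BalabanUV.T4Continuum.B13Carriers (TwoRuns)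
open Summit.QuantumFields.BalabanUV.T4Continuum.Spine.NE5
open Summit.QuantumFields.BalabanUV.T4Continuum.Spine.NE5.TwoRunTorusParam (bound238_torus_param)

section Numerics

/-! Lemma 3's printed restrictions on the constants — ONE set for all scales, verbatim the numerics of
`B13Lemma3TorusTerms.bound238_torus_of_226` (block size `L = c.L ≥ 8`, bond-layer size `M`). -/

variable {L Mb : ℕ} [NeZero L] [NeZero Mb] (c : B13.Consts) (hL : 8 ≤ c.L) (hLc : c.L = L) {a a₂ a₂' a₅ Aabs : ℝ}
variable (hα₆ : 0 < c.α₆) (hε₀ : 0 ≤ c.eps2) (hδ : 0 ≤ c.δ) (hδ7 : 0 ≤ 1 - 7 * c.δ) (hκ : 0 ≤ c.κ) (ha : 0 ≤ a)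
  (hR15 : c.R15) (hR16 : 18 * ((1 - 4 * c.δ) * c.κ) ≤ a / 20) (hR16' : 4 * c.κ ≤ a / 20)
  (hR17 : Real.exp (-(a / 20)) ≤ c.eps2) (h231 : 2 * (4 : ℝ) * (Mb : ℝ) ^ 4 * Real.exp (-(a / 10)) ≤ a / 20)
  (ha₂ : 0 ≤ a₂) (hκ229 : kappa₀ 64 8 + a₂ ≤ c.δ * c.κ)
  (hsm229 : c.α₆ * Real.exp a₂ * K₀ 64 8 * 64 ≤ a₂)
  (habsk : Real.exp (-(a / 20)) * 64 ≤ c.δ * c.κ)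
  (h18half : B13Step237.R18half c (K₀ 64 8 * Real.exp (Real.exp (-(a / 20)) * 64)))
  (h18 : B13Step237.R18sharp c (K₀ 64 8 * Real.exp (Real.exp (-(a / 20)) * 64)) ((c.L : ℝ) / 2))
  (ha₂' : 0 ≤ a₂') (hκ229' : kappa₀ 64 8 + a₂' ≤ c.δ * ((c.L : ℝ) / 2) * c.κ)
  (hsm229' : c.α₆ * Real.exp a₂' * K₀ 64 8 * 64 ≤ a₂')
  (hR20 : 18 * ((1 - 7 * c.δ) * ((c.L : ℝ) / 2) * c.κ) ≤ (c.κ₁ - 1) / 2)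
  (ha₅ : 0 ≤ a₅) (habs : a₅ + Real.exp (-((c.κ₁ - 1) / 2)) ≤ Aabs)
  (hAc : Aabs * 64 ≤ c.δ * ((c.L : ℝ) / 2) * c.κ)
  (hC3 : B13Step237.bracketF c (K₀ 64 8 * Real.exp (Real.exp (-(a / 20)) * 64)) / c.α₆ *
    Real.exp (Aabs * 64) ≤ c.C3act * c.ε₁)

include hL hLc hα₆ hε₀ hδ hδ7 hκ ha hR15 hR16 hR16' hR17 h231 ha₂ hκ229 hsm229 habsk h18half h18 ha₂' hκ229' hsm229'
  hR20 ha₅ habs hAc hC3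

/-! ## §1 One torus, any complex data space: the activity datum from the (2.26)-term layer in the data direction -/

section OneTorus

variable {N' : ℕ} [NeZero N'] {P : Type*} [NormedAddCommGroup P] [NormedSpace ℂ P]

/-- **THE H-LAYER ACTIVITY DATUM FROM THE (2.26)-TERM LAYER IN THE DATA DIRECTION (one torus, any complex data space).**
On the two-scale torus (`𝐃_{k+1} = TDom 4 N′`, `𝐃_k = TDom 4 (L·N′)`, bond layer `TBond 4 M (L·N′)`) let the activity at a
data point `z ∈ P` be the finite sum `Σ_{t ∈ terms L M Z} T Z t z` over the printed terms `t = (𝐃, P)` of `H(Z)` of ANY term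
functions `T Z t : P → ℂ`.  If on a data region `V` (hol) every `z ↦ T Z t z` is complex differentiable and (226) every term
obeys (2.26) UNIFORMLY ON `V`, `‖T Z t z‖ ≤ weight L M c Z a t · e^{a₅|Z|}`, and Lemma 3's printed restrictions on the constants
hold, then the activity is complex differentiable on `V` (finite sum) and bounded there by the printed (2.38) majorant
`C₃ε₁·e^{−(1−8δ)½Lκ·d_{k+1}(Z)}` — the tree's torus-model Lemma 3 read at every `z ∈ V`
(`TwoRunTorusParam.bound238_torus_param`; the term-sum estimate is configuration-free and is read at the one-point configuration
space). [cite: Balaban1988RG2Cluster, (1.5) p.3, (2.14) p.15, (2.26) p.17, Lemma 3 (2.38) p.20] -/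
theorem hLayer_of_terms226
    (T : (Z : TDom 4 N') → Finset (TDom 4 (L * N')) × Finset (TBond 4 Mb (L * N')) → P → ℂ) {V : Set P}
    (hhol : ∀ (Z : TDom 4 N'), ∀ t ∈ terms L Mb Z, DifferentiableOn ℂ (T Z t) V)
    (h226 : ∀ z ∈ V, ∀ (Z : TDom 4 N'), ∀ t ∈ terms L Mb Z,
      ‖T Z t z‖ ≤ weight L Mb c Z a t * Real.exp (a₅ * ((Z.1).card : ℝ))) :
    (∀ Z : TDom 4 N', DifferentiableOn ℂ (fun z => ∑ t ∈ terms L Mb Z, T Z t z) V) ∧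
      ∀ z ∈ V, ∀ Z : TDom 4 N', ‖∑ t ∈ terms L Mb Z, T Z t z‖ ≤
        c.C3act * c.ε₁ * Real.exp (-((1 - 8 * c.δ) * ((c.L : ℝ) / 2) * c.κ * torusTreeLen Z.1)) := by
  refine ⟨fun Z => DifferentiableOn.fun_sum fun t ht => hhol Z t ht, fun z hz Z => ?_⟩
  -- the one-point configuration space: the torus-model Lemma 3 reads only `Φ` and `sp2` of the step data
  let W : TwoTorusStep 4 L N' :=
    { volk := fun _ => 0, Φ := PUnit, Bond := PUnit, sp1 := fun _ => Set.univ, sp2 := fun _ => Set.univ,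
      Bv := fun _ _ => 0, Vp := fun _ _ => 0, V := fun _ _ => 0, Q := fun _ _ _ _ => 0, Vpp := fun _ _ => 0,
      H := fun _ _ => 0, Ek1 := fun _ _ => 0, Elog := fun _ _ => 0, Analytic := fun _ _ => True,
      GaugeInv := fun _ => True, Repr17 := True, Restr := True }
  have h := bound238_torus_param (B := P) c hL hLc W (fun Z t _ b => T Z t b) (V := V)
    (fun b hb Z' _ _ t ht => h226 b hb Z' t ht) hα₆ hε₀ hδ hδ7 hκ ha hR15 hR16 hR16' hR17 h231 ha₂ hκ229 hsm229 habsk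
    h18half h18 ha₂' hκ229' hsm229' hR20 ha₅ habs hAc hC3 z hz Z PUnit.unit (Set.mem_univ _)
  simpa only [tsys_dj] using h

end OneTorus

/-! ## §2 On the carriers of record: the ∃V-form of `hH`, literally the hypothesis of `EnvelopeOnRecord` -/

section Record

variable {G : Type} [GaugeGroup G] (R : TwoRuns G)
variable {Op Hist : Type*} [NormedAddCommGroup Op] [NormedSpace ℂ Op] [NormedAddCommGroup Hist] [NormedSpace ℂ Hist]
  (M : StepModel R.carriers Op Hist)

/-- **N18's W2 DATUM OF ROUTE P1 ON THE RECORD'S TORUS CATALOGUE FROM TERM-LEVEL DATA.**  For a step model `M` over row NE5's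
carriers of record `R.carriers` (`R : B13Carriers.TwoRuns G`; scale-`j` catalogue `𝐃_j = TDom 4 (R.cubesPerDir j)`, the
`j`-th torus of the record) and ANY family of term functions `T j Z t : Op × Hist → ℂ` indexed by the printed terms of
`H(Z)` on the two-scale torus over `𝐃_j`, read the activities as `act j z Z := Σ_{t ∈ terms L M Z} T j Z t z`.  IF around
every admissible base point `p ∈ M.Base j g U` there is an OPEN data region `V ⊇ M.box j p` (the two-margin box (2.16)–(2.18))
carrying (hol) holomorphy of every term in the data and (226) the per-term bound (2.26) UNIFORMLY ON `V` — NODE A's per-term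
estimate re-read on the class (1.5) — and Lemma 3's printed restrictions hold (scale-uniform), THEN the H-layer activity datum
`hH` of `EnvelopeOnRecord.outputEnvelope_of_activities_record` holds VERBATIM for these activities, with `A = C₃ε₁` and
`R_d = (1−8δ)½Lκ`.  (§1 at `N′ = R.cubesPerDir j`, `P = Op × Hist`, per base point.)
[cite: Balaban1988RG2Cluster, (1.5) p.3, p.15, (2.16)–(2.18) p.16, (2.26) p.17, (2.38) p.20] -/
theorem hH_of_terms226_record
    (T : (j : ℕ) → (Z : TDom 4 (R.cubesPerDir j)) →
      Finset (TDom 4 (L * R.cubesPerDir j)) × Finset (TBond 4 Mb (L * R.cubesPerDir j)) → Op × Hist → ℂ)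
    {W : Set (ℕ → ℝ)}
    (hT : ∀ j, ∀ g ∈ W, ∀ (U : R.carriers.BgB) (p : Op × Hist), p ∈ M.Base j g U →
      ∃ V : Set (Op × Hist), IsOpen V ∧ M.box j p ⊆ V ∧
        (∀ (Z : TDom 4 (R.cubesPerDir j)), ∀ t ∈ terms L Mb Z, DifferentiableOn ℂ (T j Z t) V) ∧
        (∀ z ∈ V, ∀ (Z : TDom 4 (R.cubesPerDir j)), ∀ t ∈ terms L Mb Z,
          ‖T j Z t z‖ ≤ weight L Mb c Z a t * Real.exp (a₅ * ((Z.1).card : ℝ)))) :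
    ∀ j, ∀ g ∈ W, ∀ (U : R.carriers.BgB) (p : Op × Hist), p ∈ M.Base j g U →
      ∃ V : Set (Op × Hist), IsOpen V ∧ M.box j p ⊆ V ∧
        (∀ Z : TDom 4 (R.cubesPerDir j),
          DifferentiableOn ℂ (fun z : Op × Hist => ∑ t ∈ terms L Mb Z, T j Z t z) V) ∧
        (∀ z ∈ V, ∀ Z : TDom 4 (R.cubesPerDir j), ‖∑ t ∈ terms L Mb Z, T j Z t z‖ ≤
          c.C3act * c.ε₁ * Real.exp (-((1 - 8 * c.δ) * ((c.L : ℝ) / 2) * c.κ * torusTreeLen Z.1))) := by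
  intro j g hg U p hp
  obtain ⟨V, hV, hbox, hhol, h226⟩ := hT j g hg U p hp
  obtain ⟨hd, hb⟩ := hLayer_of_terms226 c hL hLc hα₆ hε₀ hδ hδ7 hκ ha hR15 hR16 hR16' hR17 h231 ha₂ hκ229 hsm229
    habsk h18half h18 ha₂' hκ229' hsm229' hR20 ha₅ habs hAc hC3 (T j) hhol h226
  exact ⟨V, hV, hbox, hd, hb⟩

/-! ## §3 Route P1's W2 theorem and END on the record with W2 := term-level (2.26) data in the data direction -/

-- decidability instances as BINDERS (cf. `EnvelopeOnRecord`, technical note: any consumer's instances unify)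
variable [∀ j, DecidableEq (TDom 4 (R.cubesPerDir j))] [∀ j, DecidableRel (TTouch (d := 4) (N := R.cubesPerDir j))]

/-- **THE OUTPUT ENVELOPE ON THE CARRIERS OF RECORD FROM TERM-LEVEL (2.26) DATA** — `EnvelopeOnRecord.outputEnvelope_of_activities_record`
∘ §2: if the step's output at `⟨j, X⟩` IS (2.13) of the term sums (`hrep`: `E := locE H`, `H(Z) := Σ_t T j Z t z`, over the
torus incompatibility `TTouch`), the ∃V-form of (hol) + (226) holds around every admissible box, Lemma 3's restrictions hold,
and the two one-run clauses hold in the located numerals at NE5's rate `κ` (`κ + 128·log 162 + 2 ≤ (1−8δ)½L·c.κ`,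
`C₃ε₁·e^{5κ+1}·K₀(64,8)·576 ≤ 1` — [II] (2.39)–(2.41) p. 21 in the tree's honest constants), then
`OutputEnvelope W κ (e·9·64·K₀(64,8)²·C₃ε₁)`: on every admissible box the output is complex differentiable in the data and
bounded by the (2.41) envelope. [cite: Balaban1988RG2Cluster, (2.13) p.14, (2.26) p.17, (2.38) p.20, (2.39)–(2.41) p.21; KoteckyPreiss1986, Thm 1] -/
theorem outputEnvelope_of_terms226_record
    (T : (j : ℕ) → (Z : TDom 4 (R.cubesPerDir j)) →
      Finset (TDom 4 (L * R.cubesPerDir j)) × Finset (TBond 4 Mb (L * R.cubesPerDir j)) → Op × Hist → ℂ)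
    {W : Set (ℕ → ℝ)} {κ : ℝ}
    (hrep : ∀ (X : R.carriers.Dom) (z : Op × Hist),
      M.Out X.1 z.1 z.2 X =
        locE (TTouch (d := 4) (N := R.cubesPerDir X.1)) (fun Z : (tsys 4 (R.cubesPerDir X.1)).Dom => Z.1)
          (fun Z => ∑ t ∈ terms L Mb Z, T X.1 Z t z) X.2.1)
    (hAct : 0 ≤ c.C3act * c.ε₁) (hκ0 : 0 ≤ κ)
    (hrate : κ + 2 * (64 * Real.log 162) + 2 ≤ (1 - 8 * c.δ) * ((c.L : ℝ) / 2) * c.κ)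
    (hsmall : c.C3act * c.ε₁ * Real.exp (5 * κ + 1) * K₀ 64 8 * 9 * 64 ≤ 1)
    (hT : ∀ j, ∀ g ∈ W, ∀ (U : R.carriers.BgB) (p : Op × Hist), p ∈ M.Base j g U →
      ∃ V : Set (Op × Hist), IsOpen V ∧ M.box j p ⊆ V ∧
        (∀ (Z : TDom 4 (R.cubesPerDir j)), ∀ t ∈ terms L Mb Z, DifferentiableOn ℂ (T j Z t) V) ∧
        (∀ z ∈ V, ∀ (Z : TDom 4 (R.cubesPerDir j)), ∀ t ∈ terms L Mb Z,
          ‖T j Z t z‖ ≤ weight L Mb c Z a t * Real.exp (a₅ * ((Z.1).card : ℝ)))) :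
    M.OutputEnvelope W κ (Real.exp 1 * 9 * 64 * K₀ 64 8 ^ 2 * (c.C3act * c.ε₁)) :=
  outputEnvelope_of_activities_record R M (act := fun j z Z => ∑ t ∈ terms L Mb Z, T j Z t z) hrep hAct hκ0 hrate hsmall
    (hH_of_terms226_record c hL hLc hα₆ hε₀ hδ hδ7 hκ ha hR15 hR16 hR16' hR17 h231 ha₂ hκ229 hsm229 habsk h18half h18
      ha₂' hκ229' hsm229' hR20 ha₅ habs hAc hC3 R M T hT)

/-- **ROUTE P1's END E1′ ON THE CARRIERS OF RECORD WITH W2 := TERM-LEVEL (2.26) DATA IN THE DATA DIRECTION, BOTH W2 CLAUSES AS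
ε₁-THRESHOLDS** — `EnvelopeOnRecord.ne5_of_leaves_fibre_activities_record_eps` ∘ §2 (`C₃ := c.C3act`, `ε₁ := c.ε₁`): the W2
leaves L04op ∧ L04hist of `LeafIndex.ne5_of_leaves_fibre` are MANUFACTURED from the term data (hol) + (226) and Lemma 3's
restrictions; the [KP86] clause is `C₃ε₁·e^{5κ+1}·K₀(64,8)·576 ≤ 1` and the route's sharp clause is
`(e·576·K₀(64,8)²·C₃)·c_H·ε₁ < (θ′−ω)(1−ρ₀)` (ONE `ε⋆ > 0` for both: `EnvelopeOnRecord.eps_threshold_record`); every other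
leaf — L01–L03 (identification), L05∕L06 (levels), L07 (row NE2's operator rate), L08 (insertion rate), L09aff ∧ L09blind ∧
L09hom ∧ L09unit (W3 at gain `c_H`), L10 — displayed unchanged.  Conclusion literally `T4OutputRate.NE5 EA EB W κ θ′ C₅` on
`R.carriers`. [cite: Balaban1988RG2Cluster, (2.13) p.14, (2.26) p.17, (2.38) p.20, (2.39)–(2.41) p.21; Balaban1987RG1, (0.24) p.257, Thm 1 p.259] -/
theorem ne5_of_leaves_fibre_terms226_record_eps
    (T : (j : ℕ) → (Z : TDom 4 (R.cubesPerDir j)) →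
      Finset (TDom 4 (L * R.cubesPerDir j)) × Finset (TBond 4 Mb (L * R.cubesPerDir j)) → Op × Hist → ℂ)
    {W : Set (ℕ → ℝ)} {κ : ℝ}
    (hrep : ∀ (X : R.carriers.Dom) (z : Op × Hist),
      M.Out X.1 z.1 z.2 X =
        locE (TTouch (d := 4) (N := R.cubesPerDir X.1)) (fun Z : (tsys 4 (R.cubesPerDir X.1)).Dom => Z.1)
          (fun Z => ∑ t ∈ terms L Mb Z, T X.1 Z t z) X.2.1)
    (hC3nn : 0 ≤ c.C3act) (hε₁ : 0 ≤ c.ε₁) (hκ0 : 0 ≤ κ)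
    (hrate : κ + 2 * (64 * Real.log 162) + 2 ≤ (1 - 8 * c.δ) * ((c.L : ℝ) / 2) * c.κ)
    (hKP : c.C3act * c.ε₁ * Real.exp (5 * κ + 1) * K₀ 64 8 * 9 * 64 ≤ 1)
    (hT : ∀ j, ∀ g ∈ W, ∀ (U : R.carriers.BgB) (p : Op × Hist), p ∈ M.Base j g U →
      ∃ V : Set (Op × Hist), IsOpen V ∧ M.box j p ⊆ V ∧
        (∀ (Z : TDom 4 (R.cubesPerDir j)), ∀ t ∈ terms L Mb Z, DifferentiableOn ℂ (T j Z t) V) ∧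
        (∀ z ∈ V, ∀ (Z : TDom 4 (R.cubesPerDir j)), ∀ t ∈ terms L Mb Z,
          ‖T j Z t z‖ ≤ weight L Mb c Z a t * Real.exp (a₅ * ((Z.1).card : ℝ))))
    {EA : Functional R.carriers R.carriers.BgA} {EB : Functional R.carriers R.carriers.BgB}
    {EA₀ E₀ E₁ δ δ' θ θ' cH ω ρ₀ B : ℝ} {k₀ : ℕ}
    (l01 : L01 M EA W) (l02 : L02 M EB W) (l03 : L03 M EB W) (l05 : L05 EA W EA₀ κ) (l06 : L06 EB W E₀ κ)
    (l07 : L07 M W δ θ) (l08 : L08 M W κ E₀ δ' θ) (l09aff : L09aff M W) (l09blind : L09blind M W) (l09hom : L09hom M W)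
    (l09unit : L09unit M W κ E₁ cH ω) (hE₁ : 0 < E₁) (hδδ' : 0 ≤ δ + δ') (hθ : 0 ≤ θ) (hθθ' : θ ≤ θ') (hθ'1 : θ' ≤ 1)
    (hcH : 0 ≤ cH) (hω : 0 < ω) (hρ₀ : ρ₀ < 1) (l10near : (δ + δ') * θ ^ k₀ + cH * (EA₀ + E₀) / (1 - ω) ≤ ρ₀) (hB : 0 ≤ B)
    (l10first : ∀ k < k₀, EA₀ + E₀ ≤ B * θ ^ k)
    (hS : Real.exp 1 * 9 * 64 * K₀ 64 8 ^ 2 * c.C3act * cH * c.ε₁ < (θ' - ω) * (1 - ρ₀)) :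
    NE5 EA EB W κ θ'
      ((Real.exp 1 * 9 * 64 * K₀ 64 8 ^ 2 * (c.C3act * c.ε₁) / (1 - ρ₀) * (δ + δ') + B) * (θ' - ω) /
        (θ' - (ω + Real.exp 1 * 9 * 64 * K₀ 64 8 ^ 2 * (c.C3act * c.ε₁) / (1 - ρ₀) * cH))) :=
  ne5_of_leaves_fibre_activities_record_eps R M (act := fun j z Z => ∑ t ∈ terms L Mb Z, T j Z t z) hrep hC3nn hε₁ hκ0
    hrate hKP
    (hH_of_terms226_record c hL hLc hα₆ hε₀ hδ hδ7 hκ ha hR15 hR16 hR16' hR17 h231 ha₂ hκ229 hsm229 habsk h18half h18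
      ha₂' hκ229' hsm229' hR20 ha₅ habs hAc hC3 R M T hT)
    l01 l02 l03 l05 l06 l07 l08 l09aff l09blind l09hom l09unit hE₁ hδδ' hθ hθθ' hθ'1 hcH hω hρ₀ l10near hB l10first hS

end Record

end Numerics

end Summit.QuantumFields.YangMills.BalabanUVNodes.N18HLayerDatum

end
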